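import Summits.ABC.ABC.Theses.IsogenyGlueCongruence
import Literature.NumberTheory.EllipticCurves.DegreeConjectureAbcPrelims
import Literature.NumberTheory.EllipticCurves.CuspFormLFunctionFrickeProofs
import Literature.NumberTheory.EllipticCurves.CongruenceNumber

/-!
# `TorsionSharingPrimeBound` (stmt-ABC-2157, route ABC/IsogenyGlueCongruence) — negative-side lemmas I

Standing-adversary (cdisprove) output for the crux
`K = Summit.ABC.ABC.Theses.IsogenyGlueCongruence.TorsionSharingPrimeBound` (congruence primes `ℓ`
between `f_W`, `W` semistable of conductor `N`, and any other newform `g` of level `M` satisfy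
`ℓ ≤ C (M N)^κ`). No kill: a counterexample family would refute polynomial Szpiro for semistable
curves, hence ABC (work file `Cruxes/TorsionSharingPrimeBound/Disproof.lean` §7). Proved here
(variants of K are written INLINE in the theorem statements; no new named facts):
* `congruentAway_of_int` — an honest integer congruence instantiates the `(R, F, φ)` hypothesis;
* `torsionSharingPrimeBound_false_without_ne_of_modularity` — K without `g ≠ f_W` is false modulo
  the modularity fact `exists_isNewformOf`;
* `torsionSharingPrimeBound_false_without_normalisation_of_modularity` — K without `a₁(g) = 1` is
  false modulo `exists_isNewformOf` (witness `(ℓ+1) • f_W`: the `(R, F, φ)` quantifier is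
  scale-blind, only the normalisation inside `IsNewform0` excludes rescalings);
* `torsionSharingPrimeBound_false_without_eigen_of_twoIntegralNewforms` — K without the Hecke-eigen
  condition is false modulo two integral new vectors at one level (level 37; witness
  `(1−ℓ) • f_W + ℓ • f'`);
* `isNewformOf_of_torsionSharingPrimeBound` — K proves that a newform of ANY level with integer
  `b_p = a_p(W)` for all `p ∤ M N` is `f_W`: any proof of K contains strong multiplicity one /
  level = conductor for such pairs (named facts `IsNewform0.eq_of_heckeEigenvalue_eq`,
  `IsNewform0.level_eq_of_heckeEigenvalue_eq`, `IsNewformOf.level_eq_conductorNorm`);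
* `not_torsionSharingPrimeBound_levelFree_of_unboundedCongruencePrimes` — the level-free bound
  `ℓ ≤ C N^κ` is false modulo Ribet's level raising: the partner level `M` is load-bearing;
* `torsionSharingPrimeBound_conclusion_false_without_hypotheses`.
`W30 : y² + xy = x³ + 4x² + x` (conductor 30) carries all side conditions of K with proofs from the
tree. Refuter seat cdisprove-stmt-ABC-2157, 2026-08-16.
-/

noncomputable section

open scoped MatrixGroups ModularForm
open CongruenceSubgroup
open Literature.NumberTheory.EllipticCurves.ModularForms
open Literature.NumberTheory.EllipticCurves
open Summit.ABC.ABC.Theses.IsogenyGlueCongruence (TorsionSharingPrimeBound)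

set_option linter.dupNamespace false

namespace Summit.ABC.ABC.Theorems.TorsionSharingPrimeBound.Negative

/-! ## §0 The congruence hypothesis, isolated -/
/-- `CongruentAway W M g ℓ`: the congruence hypothesis of the crux — some subring `R ⊆ ℂ` containing
all `aₙ(g)`, some field `F` of characteristic `ℓ` and ring map `φ : R → F` with
`φ(a_p(g)) = a_p(W)` for every prime `p ∤ M · N_W · ℓ`. For `R = ℤ[aₙ(g)]` this is
"`f_W ≡ g` modulo a prime above `ℓ`", i.e. `ρ̄_{g,λ}^{ss} ≅ ρ̄_{W,ℓ}^{ss}`. [folklore] -/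
def CongruentAway (W : WeierstrassCurve ℚ) (M : ℕ) [NeZero M] (g : CuspForm (Gamma0 M) 2)
    (ℓ : ℕ) : Prop :=
  ∃ (R : Subring ℂ) (F : Type) (_ : Field F) (_ : CharP F ℓ) (φ : R →+* F)
    (hg : ∀ n : ℕ, cuspCoeff g n ∈ R),
    ∀ p : ℕ, p.Prime → ¬ (p ∣ M * W.conductorNorm ℤ * ℓ) →
      φ ⟨cuspCoeff g p, hg p⟩ = ((W.LFunction p : ℤ) : F)

/-- The crux, restated through `CongruentAway` (definitional reshuffling of the `∀ R F φ hg`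
binders into one hypothesis). [folklore] -/
theorem torsionSharingPrimeBound_iff :
    TorsionSharingPrimeBound ↔ ∃ κ C : ℝ, 0 ≤ κ ∧ ∀ (W : WeierstrassCurve ℚ) [W.IsElliptic]
    [W.IsGloballyMinimal] [NeZero (W.conductorNorm ℤ)], W.IsSemistable ℤ →
    ∀ (M : ℕ) [NeZero M] (g : CuspForm (Gamma0 M) 2), IsNewform0 g → ¬ IsNewformOf W g →
    ∀ ℓ : ℕ, ℓ.Prime → CongruentAway W M g ℓ →
    (ℓ : ℝ) ≤ C * ((M : ℝ) * (W.conductorNorm ℤ : ℝ)) ^ κ := by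
  constructor
  · rintro ⟨κ, C, hκ, h⟩
    refine ⟨κ, C, hκ, ?_⟩
    intro W _ _ _ hW M _ g hg hne ℓ hℓ hc
    obtain ⟨R, F, _, _, φ, hgR, hc⟩ := hc
    exact h W hW M g hg hne ℓ hℓ R F φ hgR hc
  · rintro ⟨κ, C, hκ, h⟩
    refine ⟨κ, C, hκ, ?_⟩
    intro W _ _ _ hW M _ g hg hne ℓ hℓ R F _ _ φ hgR hc
    exact h W hW M g hg hne ℓ hℓ ⟨R, F, ‹_›, ‹_›, φ, hgR, hc⟩

/-- An honest integer congruence instantiates the hypothesis: if `aₙ(g) = bₙ ∈ ℤ` for all `n` and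
`b_p ≡ a_p(W) (mod ℓ)` for the primes `p ∤ M N ℓ`, then `CongruentAway W M g ℓ`
(take `R = ℤ ⊆ ℂ`, `F = ZMod ℓ`, `φ` = reduction mod `ℓ`). [folklore] -/
theorem congruentAway_of_int {W : WeierstrassCurve ℚ} {M : ℕ} [NeZero M]
    {g : CuspForm (Gamma0 M) 2} (b : ℕ → ℤ) (hb : ∀ n, cuspCoeff g n = (b n : ℂ)) {ℓ : ℕ}
    (hℓ : ℓ.Prime)
    (hcong : ∀ p : ℕ, p.Prime → ¬ (p ∣ M * W.conductorNorm ℤ * ℓ) →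
      ((b p : ℤ) : ZMod ℓ) = ((W.LFunction p : ℤ) : ZMod ℓ)) :
    CongruentAway W M g ℓ := by
  classical
  haveI : Fact ℓ.Prime := ⟨hℓ⟩
  let ι : ℤ →+* ℂ := Int.castRingHom ℂ
  have hinj : Function.Injective ι.rangeRestrict := by
    intro x y hxy
    have : (ι.rangeRestrict x : ℂ) = ι.rangeRestrict y := by rw [hxy]
    simpa [ι] using this
  let e : ℤ ≃+* ι.range := RingEquiv.ofBijective ι.rangeRestrict ⟨hinj, ι.rangeRestrict_surjective⟩
  refine ⟨ι.range, ZMod ℓ, inferInstance, inferInstance,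
    (Int.castRingHom (ZMod ℓ)).comp e.symm.toRingHom, fun n ↦ ⟨b n, by simp [ι, hb n]⟩, ?_⟩
  intro p hp hpd
  have he : e.symm ⟨cuspCoeff g p, ⟨b p, by simp [ι, hb p]⟩⟩ = b p := by
    apply e.injective
    rw [RingEquiv.apply_symm_apply]
    ext
    simp [e, ι, hb p]
  simp only [RingHom.coe_comp, RingEquiv.toRingHom_eq_coe, RingHom.coe_coe, Function.comp_apply]
  rw [he]
  simpa using hcong p hp hpd

/-! ### A concrete semistable, globally minimal elliptic curve: `W30 : y² + xy = x³ + 4x² + x`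
(B–G (12.18) with `(A, B) = (−1, 16)`, the Frey curve of `1 + 15 = 16`, conductor 30); all four side
conditions of the crux are PROVED for it in the tree. -/

/-- `W30 = (12.18) for (A, B) = (−1, 16)`. [folklore] -/
def W30 : WeierstrassCurve ℚ := (freyIntModel₂ (-1) 16).baseChange ℚ

/-- `W30` is an elliptic curve (`isElliptic_freyIntModel₂`). [folklore] -/
instance W30.isElliptic : W30.IsElliptic :=
  isElliptic_freyIntModel₂ (by norm_num) (by norm_num) (by norm_num)

/-- `−1` and `16` are coprime. [folklore] -/
theorem isCoprime_neg_one_sixteen : IsCoprime (-1 : ℤ) 16 := isCoprime_one_left.neg_left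

/-- `W30` is minimal at every prime (`isMinimalAt_freyIntModel₂`, B–G Ex. 12.5.10 (a)). [folklore] -/
theorem W30_isMinimalAt (v : IsDedekindDomain.HeightOneSpectrum ℤ) : W30.IsMinimalAt v :=
  isMinimalAt_freyIntModel₂ isCoprime_neg_one_sixteen (by norm_num) (by norm_num) v

/-- `W30` is a global minimal model (minimal at every prime). [folklore] -/
instance W30.isGloballyMinimal : W30.IsGloballyMinimal :=
  isGloballyMinimal_of_forall_isMinimalAt_int _ W30_isMinimalAt

/-- The conductor of `W30` is non-zero (`conductorNorm_pos_holds`). [folklore] -/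
instance W30.neZero_conductorNorm : NeZero (W30.conductorNorm ℤ) :=
  ⟨(WeierstrassCurve.conductorNorm_pos_holds W30).ne'⟩

/-- `W30` is semistable (`isSemistableAt_freyIntModel₂`). [folklore] -/
theorem W30_isSemistable : W30.IsSemistable ℤ := fun v ↦
  isSemistableAt_freyIntModel₂ isCoprime_neg_one_sixteen (by norm_num) (by norm_num) (by norm_num) v

/-- A prime beyond any real bound. [folklore] -/
theorem exists_prime_gt (B : ℝ) : ∃ ℓ : ℕ, ℓ.Prime ∧ B < ℓ := by
  obtain ⟨ℓ, hge, hℓ⟩ := Nat.exists_infinite_primes (⌈B⌉₊ + 1)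
  refine ⟨ℓ, hℓ, ?_⟩
  have h1 : (⌈B⌉₊ : ℝ) + 1 ≤ ℓ := by exact_mod_cast hge
  linarith [Nat.le_ceil B]

/-! ## §1 `¬ IsNewformOf W g` is load-bearing -/
/-- **`g ≠ f_W` is load-bearing.** K with the hypothesis `¬ IsNewformOf W g` deleted is FALSE,
modulo the modularity fact `exists_isNewformOf` (named Literature fact, Wiles/BCDT): `g = f_{W30}`
is congruent to `W30` modulo every prime `ℓ`, while the bound `C (N₀ N₀)^κ` is fixed. [folklore] -/
theorem torsionSharingPrimeBound_false_without_ne_of_modularity (hmod : exists_isNewformOf) :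
    ¬ ∃ κ C : ℝ, 0 ≤ κ ∧ ∀ (W : WeierstrassCurve ℚ) [W.IsElliptic]
      [W.IsGloballyMinimal] [NeZero (W.conductorNorm ℤ)], W.IsSemistable ℤ →
      ∀ (M : ℕ) [NeZero M] (g : CuspForm (Gamma0 M) 2), IsNewform0 g →
      ∀ ℓ : ℕ, ℓ.Prime → CongruentAway W M g ℓ →
      (ℓ : ℝ) ≤ C * ((M : ℝ) * (W.conductorNorm ℤ : ℝ)) ^ κ := by
  rintro ⟨κ, C, -, h⟩
  obtain ⟨f, hf⟩ := hmod W30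
  obtain ⟨ℓ, hℓ, hℓgt⟩ :=
    exists_prime_gt (C * ((W30.conductorNorm ℤ : ℝ) * (W30.conductorNorm ℤ : ℝ)) ^ κ)
  have hcong : CongruentAway W30 (W30.conductorNorm ℤ) f ℓ :=
    congruentAway_of_int (fun n ↦ W30.LFunction n) (fun n ↦ hf.2 n) hℓ (fun _ _ _ ↦ rfl)
  have hle := h W30 W30_isSemistable (W30.conductorNorm ℤ) f hf.1 ℓ hℓ hcong
  linarith

/-! ## §2 The normalisation `a₁(g) = 1` is load-bearing -/
/-- **The normalisation `a₁(g) = 1` is load-bearing.** K with `IsNewform0 g` weakened to "`g` is a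
Hecke eigenform in the new subspace" is FALSE, modulo `exists_isNewformOf`: for a prime `ℓ` beyond
the bound, `g = (ℓ + 1) • f_{W30}` lies in the new subspace, is a Hecke eigenform, is not `f_{W30}`
(`a₁(g) = ℓ + 1 ≠ 1`), and `aₙ(g) = (ℓ+1) aₙ(W30) ≡ aₙ(W30) (mod ℓ)` for all `n`. So any proof of
K
uses `a₁(g) = 1` — and uses it only to exclude rescalings, since the `(R, F, φ)` quantification is
otherwise scale-blind. [folklore] -/
theorem torsionSharingPrimeBound_false_without_normalisation_of_modularity
    (hmod : exists_isNewformOf) :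
    ¬ ∃ κ C : ℝ, 0 ≤ κ ∧ ∀ (W : WeierstrassCurve ℚ) [W.IsElliptic]
      [W.IsGloballyMinimal] [NeZero (W.conductorNorm ℤ)], W.IsSemistable ℤ →
      ∀ (M : ℕ) [NeZero M] (g : CuspForm (Gamma0 M) 2), g ∈ newSubspace0 M 2 →
      IsHeckeEigenform g → ¬ IsNewformOf W g → ∀ ℓ : ℕ, ℓ.Prime → CongruentAway W M g ℓ →
      (ℓ : ℝ) ≤ C * ((M : ℝ) * (W.conductorNorm ℤ : ℝ)) ^ κ := by
  rintro ⟨κ, C, -, h⟩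
  obtain ⟨f, hf⟩ := hmod W30
  obtain ⟨ℓ, hℓ, hℓgt⟩ :=
    exists_prime_gt (C * ((W30.conductorNorm ℤ : ℝ) * (W30.conductorNorm ℤ : ℝ)) ^ κ)
  set c : ℤ := ℓ + 1 with hc
  set g : CuspForm (Gamma0 (W30.conductorNorm ℤ)) 2 := (c : ℂ) • f with hg
  have hnew : g ∈ newSubspace0 (W30.conductorNorm ℤ) 2 :=
    (newSubspace0 (W30.conductorNorm ℤ) 2).smul_mem _ hf.1.1
  have heig : IsHeckeEigenform g := by
    intro p hp
    obtain ⟨a, ha⟩ := hf.1.2.1 p hp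
    refine ⟨a, ?_⟩
    rw [hg, map_smul, ha, smul_comm]
  have hcoeff : ∀ n, cuspCoeff g n = ((c * W30.LFunction n : ℤ) : ℂ) := by
    intro n
    rw [hg, cuspCoeff_smul, hf.2 n]
    push_cast
    ring
  have hne : ¬ IsNewformOf W30 g := by
    intro hgW
    have h1 : cuspCoeff g 1 = 1 := hgW.1.2.2
    have h1' : cuspCoeff f 1 = 1 := hf.1.2.2
    rw [hg, cuspCoeff_smul, h1'] at h1
    have : (c : ℂ) = 1 := by simpa using h1
    have hc1 : c = 1 := by exact_mod_cast this
    have := hℓ.two_le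
    omega
  have hcong : CongruentAway W30 (W30.conductorNorm ℤ) g ℓ := by
    refine congruentAway_of_int (fun n ↦ c * W30.LFunction n) hcoeff hℓ (fun p _ _ ↦ ?_)
    push_cast
    simp [hc]
  have hle := h W30 W30_isSemistable (W30.conductorNorm ℤ) g hnew heig hne ℓ hℓ hcong
  linarith

/-! ## §3 The Hecke-eigen condition is load-bearing -/
/-- **The Hecke-eigen condition is load-bearing.** K with `IsNewform0 g` weakened to "`g` is a
normalised element of the new subspace" is FALSE, modulo the hypothesis `h2` (TRUE, printed; kept as a
hypothesis for relocation): some semistable, globally minimal elliptic `W/ℚ` of conductor `N` has,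
besides its newform `f`, a second vector `f'` in `S₂(Γ₀(N))^{new}` with INTEGER coefficients `bₙ`,
`b₁ = 1`, `bₙ ≠ aₙ(W)` for some `n` — instance `N = 37` (prime level, `S₂(Γ₀(37))` new of dimension 2,
rational newforms 37a1: `q − 2q² − 3q³ + …`, 37b1: `q + q³ − 2q⁴ + …`; Cremona 1997, Table 3). For `ℓ`
beyond the bound, `g = (1 − ℓ) • f + ℓ • f'` is in the new subspace, normalised (`a₁ = (1−ℓ) + ℓ = 1`), has
`aₙ(g) = aₙ(W) + ℓ (bₙ − aₙ(W)) ≡ aₙ(W) (mod ℓ)` for all `n`, and `≠ f_W` at the index where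
`bₙ ≠ aₙ(W)`. So any proof of K uses that `g` is an eigenform (the congruence alone does not see
it). [folklore] -/
theorem torsionSharingPrimeBound_false_without_eigen_of_twoIntegralNewforms
    (h2 : ∃ (W : WeierstrassCurve ℚ) (_ : W.IsElliptic) (_ : W.IsGloballyMinimal)
      (_ : NeZero (W.conductorNorm ℤ)), W.IsSemistable ℤ ∧
      ∃ (f f' : CuspForm (Gamma0 (W.conductorNorm ℤ)) 2) (b : ℕ → ℤ), IsNewformOf W f ∧
        f' ∈ newSubspace0 (W.conductorNorm ℤ) 2 ∧ (∀ n, cuspCoeff f' n = (b n : ℂ)) ∧ b 1 = 1 ∧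
        ∃ n, b n ≠ W.LFunction n) :
    ¬ ∃ κ C : ℝ, 0 ≤ κ ∧ ∀ (W : WeierstrassCurve ℚ) [W.IsElliptic]
      [W.IsGloballyMinimal] [NeZero (W.conductorNorm ℤ)], W.IsSemistable ℤ →
      ∀ (M : ℕ) [NeZero M] (g : CuspForm (Gamma0 M) 2), g ∈ newSubspace0 M 2 → IsNormalized g →
      ¬ IsNewformOf W g → ∀ ℓ : ℕ, ℓ.Prime → CongruentAway W M g ℓ →
      (ℓ : ℝ) ≤ C * ((M : ℝ) * (W.conductorNorm ℤ : ℝ)) ^ κ := by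
  rintro ⟨κ, C, -, h⟩
  obtain ⟨W, _, _, _, hW, f, f', b, hf, hf'new, hb, hb1, n₀, hn₀⟩ := h2
  obtain ⟨ℓ, hℓ, hℓgt⟩ :=
    exists_prime_gt (C * ((W.conductorNorm ℤ : ℝ) * (W.conductorNorm ℤ : ℝ)) ^ κ)
  set g : CuspForm (Gamma0 (W.conductorNorm ℤ)) 2 :=
    ((1 - ℓ : ℤ) : ℂ) • f + ((ℓ : ℤ) : ℂ) • f' with hg
  have hnew : g ∈ newSubspace0 (W.conductorNorm ℤ) 2 :=
    (newSubspace0 _ 2).add_mem ((newSubspace0 _ 2).smul_mem _ hf.1.1)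
      ((newSubspace0 _ 2).smul_mem _ hf'new)
  have hcoeff : ∀ n, cuspCoeff g n = (((1 - ℓ) * W.LFunction n + ℓ * b n : ℤ) : ℂ) := by
    intro n
    have h1 : (1 : ℝ) ∈ (Gamma0 (W.conductorNorm ℤ) : Subgroup (GL (Fin 2) ℝ)).strictPeriods :=
      strictWidthInfty_Gamma0 (W.conductorNorm ℤ) ▸
        (Gamma0 (W.conductorNorm ℤ) : Subgroup (GL (Fin 2) ℝ)).strictWidthInfty_mem_strictPeriods
    rw [hg, cuspCoeff_add_form h1, cuspCoeff_smul, cuspCoeff_smul, hf.2 n, hb n]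
    push_cast
    ring
  have hL1 : W.LFunction 1 = 1 := by
    have h1 : cuspCoeff f 1 = 1 := hf.1.2.2
    rw [hf.2 1] at h1
    exact_mod_cast h1
  have hnorm : IsNormalized g := by
    show cuspCoeff g 1 = 1
    rw [hcoeff 1, hL1, hb1]
    push_cast
    ring
  have hne : ¬ IsNewformOf W g := by
    intro hgW
    have h0 := hgW.2 n₀
    rw [hcoeff n₀] at h0
    have h0' : (1 - (ℓ : ℤ)) * W.LFunction n₀ + ℓ * b n₀ = W.LFunction n₀ := by exact_mod_cast h0
    have h1 : (ℓ : ℤ) * (b n₀ - W.LFunction n₀) = 0 := by linear_combination h0'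
    rcases mul_eq_zero.mp h1 with h | h
    · exact hℓ.ne_zero (by exact_mod_cast h)
    · exact hn₀ (sub_eq_zero.mp h)
  have hcong : CongruentAway W (W.conductorNorm ℤ) g ℓ := by
    refine congruentAway_of_int (fun n ↦ (1 - ℓ) * W.LFunction n + ℓ * b n) hcoeff hℓ
      (fun p _ _ ↦ ?_)
    push_cast
    simp
  have hle := h W hW (W.conductorNorm ℤ) g hnew hnorm hne ℓ hℓ hcong
  linarith

/-! ## §4 What any proof of K must contain: multiplicity one for the pairs `(f_W, g)` -/
/-- **K proves a strong-multiplicity-one statement.** If K holds, then for every semistable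
`W`
(globally minimal, conductor `N`) and every newform `g` of ANY level `M` whose Fourier coefficients
are integers `bₙ` with `b_p = a_p(W)` for all primes `p ∤ M N`, already `IsNewformOf W g` (all
`aₙ(g) = aₙ(W)`; with the fact `IsNewformOf.level_eq_conductorNorm`, also `M = N`). Proof: otherwise
`g` is an admissible partner congruent to `W` modulo EVERY prime `ℓ`, contradicting the fixed bound.
Hence any proof of K contains (for such pairs) Atkin–Lehner–Li strong multiplicity one and
Carayol's level = conductor — in the tree the named facts `IsNewform0.eq_of_heckeEigenvalue_eq`,
`IsNewform0.level_eq_of_heckeEigenvalue_eq`, `IsNewform0.heckeEigenvalue_eq_coeff`,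
`IsNewformOf.level_eq_conductorNorm`; they are unavoidable imports for a prover. [folklore] -/
theorem isNewformOf_of_torsionSharingPrimeBound (hK : TorsionSharingPrimeBound) {W : WeierstrassCurve ℚ} [W.IsElliptic]
    [W.IsGloballyMinimal]
    [NeZero (W.conductorNorm ℤ)] (hW : W.IsSemistable ℤ) {M : ℕ} [NeZero M]
    {g : CuspForm (Gamma0 M) 2} (hg : IsNewform0 g) (b : ℕ → ℤ)
    (hb : ∀ n, cuspCoeff g n = (b n : ℂ))
    (heq : ∀ p : ℕ, p.Prime → ¬ (p ∣ M * W.conductorNorm ℤ) → b p = W.LFunction p) :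
    IsNewformOf W g := by
  by_contra hne
  obtain ⟨κ, C, -, h⟩ := torsionSharingPrimeBound_iff.mp hK
  obtain ⟨ℓ, hℓ, hℓgt⟩ := exists_prime_gt (C * ((M : ℝ) * (W.conductorNorm ℤ : ℝ)) ^ κ)
  have hcong : CongruentAway W M g ℓ := by
    refine congruentAway_of_int b hb hℓ (fun p hp hpd ↦ ?_)
    rw [heq p hp (fun hd ↦ hpd (dvd_mul_of_dvd_left hd ℓ))]
  have hle := h W hW M g hg hne ℓ hℓ hcong
  linarith

/-! ## §5 The level `M` in the bound is load-bearing (level raising) -/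
/-- **The partner level `M` in `(M N)^κ` is load-bearing.** The LEVEL-FREE strengthening of K
(`ℓ ≤ C N^κ`) is FALSE modulo the hypothesis `hU` (TRUE, printed; kept as a hypothesis for
relocation): ONE fixed semistable `W` admits newform partners `g ≠ f_W` congruent to it modulo
arbitrarily large primes `ℓ` — level raising: for `ℓ ≥ 11` (`ρ̄_{W,ℓ}` irreducible, Mazur) and a prime
`p ∤ N ℓ` with `a_p(W) ≡ ±(p+1) (mod ℓ)` (Chebotarev), there is a newform of level `N p`, new at
`p`, with `ρ̄_g ≅ ρ̄_{W,ℓ}` (Ribet 1984, Thm. 1; Diamond–Taylor 1994, Thm. A). Such `ℓ` divide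
`(p+1)² − a_p²`, so `ℓ ≤ (√p+1)² ≤ 4M/N`: harmless for K, fatal for the level-free form.
[cite: DiamondTaylor1994, Thm. A] -/
theorem not_torsionSharingPrimeBound_levelFree_of_unboundedCongruencePrimes
    (hU : ∃ (W : WeierstrassCurve ℚ) (_ : W.IsElliptic) (_ : W.IsGloballyMinimal)
      (_ : NeZero (W.conductorNorm ℤ)), W.IsSemistable ℤ ∧
      ∀ B : ℝ, ∃ ℓ : ℕ, ℓ.Prime ∧ B < ℓ ∧ ∃ (M : ℕ) (_ : NeZero M) (g : CuspForm (Gamma0 M) 2),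
        IsNewform0 g ∧ ¬ IsNewformOf W g ∧ CongruentAway W M g ℓ) :
    ¬ ∃ κ C : ℝ, 0 ≤ κ ∧ ∀ (W : WeierstrassCurve ℚ) [W.IsElliptic]
      [W.IsGloballyMinimal] [NeZero (W.conductorNorm ℤ)], W.IsSemistable ℤ →
      ∀ (M : ℕ) [NeZero M] (g : CuspForm (Gamma0 M) 2), IsNewform0 g → ¬ IsNewformOf W g →
      ∀ ℓ : ℕ, ℓ.Prime → CongruentAway W M g ℓ → (ℓ : ℝ) ≤ C * (W.conductorNorm ℤ : ℝ) ^ κ := by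
  rintro ⟨κ, C, -, h⟩
  obtain ⟨W, _, _, _, hW, hU⟩ := hU
  obtain ⟨ℓ, hℓ, hℓgt, M, _, g, hg, hne, hcong⟩ := hU (C * (W.conductorNorm ℤ : ℝ) ^ κ)
  have hle := h W hW M g hg hne ℓ hℓ hcong
  linarith

/-! ## §6 The bare conclusion is false -/
/-- The hypothesis-free shape of the conclusion is false (take `M = N = 1`). [folklore] -/
theorem torsionSharingPrimeBound_conclusion_false_without_hypotheses :
    ¬ ∃ κ C : ℝ, ∀ M N ℓ : ℕ, ℓ.Prime → (ℓ : ℝ) ≤ C * ((M : ℝ) * (N : ℝ)) ^ κ := by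
  rintro ⟨κ, C, h⟩
  obtain ⟨ℓ, hℓ, hℓgt⟩ := exists_prime_gt C
  have := h 1 1 ℓ hℓ
  simp at this
  linarith

end Summit.ABC.ABC.Theorems.TorsionSharingPrimeBound.Negative

end
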